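import Mathlib.Analysis.CStarAlgebra.GelfandNaimarkSegal
import Mathlib.Analysis.CStarAlgebra.Classes
import Mathlib.Analysis.Normed.Module.WeakDual
import Mathlib.Analysis.Convex.Extreme
import Mathlib.Algebra.Algebra.Subalgebra.Centralizer
import HarnessLib

-- provenance: harness21/H21/H21/Prelude/QLatticeAQFT/CStarState.lean @ c661e31 (interim HEAD d8f2665); M5 mechanical rewrite
/-!
# States on unital C⋆-algebras and the GNS cyclic vector

Trunk: `QLatticeAQFT` (prelude item Q12 `CStarState`, notion `cstar_state_gns`).

A *state* on a unital C⋆-algebra `A` is a positive linear functional `ω : A → ℂ` with `ω 1 = 1`.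
We bundle states as a structure `Literature.State A` on top of Mathlib's positive linear maps
`A →ₚ[ℂ] ℂ` (`PositiveLinearMap`), and provide

* the coercions to continuous linear functionals (continuity of positive maps between
  C⋆-algebras is Mathlib's automatic `ContinuousLinearMapClass` instance in
  `Mathlib/Analysis/CStarAlgebra/PositiveLinearMap.lean`) and to the weak-⋆ dual `WeakDual ℂ A`;
* the *state space* `Literature.stateSpace A ⊆ WeakDual ℂ A` and *pure states* (extreme points);
* the GNS triple `(gnsSpace ω, gnsRep ω, gnsVector ω)`: the Hilbert space and representation are
  Mathlib's `PositiveLinearMap.GNS` and `PositiveLinearMap.gnsStarAlgHom`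
  (`Mathlib/Analysis/CStarAlgebra/GelfandNaimarkSegal.lean`); the cyclic vector
  `Ω_ω := [1] ∈ overline(A/N_ω)` is *defined here* (it is a TODO in that Mathlib file);
* pull-back of states along unital ⋆-homomorphisms (`State.comap`);
* API statements (proofs `sorry`): `‖Ω‖ = 1`, `⟪Ω, π(a) Ω⟫ = ω a`, cyclicity of `Ω`, convexity and
  weak-⋆ compactness of the state space, `‖ω a‖ ≤ ‖a‖`, and "pure ⇔ GNS irreducible".

Mathlib search: Mathlib has `PositiveLinearMap`, its GNS space/representation and
`WeakDual.CharacterSpace` (multiplicative states), but no notion of (general) state, state space,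
pure state or GNS cyclic vector (grep `State`, `cyclic`, `IsPure` in
`Mathlib/Analysis/CStarAlgebra`).

Design choices.
* We work over `[CStarAlgebra A] [PartialOrder A] [StarOrderedRing A]`, the Mathlib spelling of
  "unital C⋆-algebra with its positive cone", and use `open scoped ComplexOrder` for the order
  on `ℂ`.
* `stateSpace A` is a subset of `WeakDual ℂ A` (not of `State A`) so that convexity over `ℝ` and
  Banach–Alaoglu compactness are stated in Mathlib's weak-⋆ dual directly.
* Irreducibility of a ⋆-representation `π : A →⋆ₐ[ℂ] (H →L[ℂ] H)` is spelled "trivial commutant":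
  `Subalgebra.centralizer ℂ (Set.range π) = ⊥` (Schur's-lemma form, BR I Prop. 2.3.8).

References: O. Bratteli, D. W. Robinson, *Operator Algebras and Quantum Statistical Mechanics I*
(2nd ed., 1987), §2.3.2 (states), §2.3.3 (GNS), Thm. 2.3.16, Thm. 2.3.19 (pure ⇔ irreducible),
Thm. 2.3.15 (state space weak-⋆ compact for unital `A`); R. V. Kadison, J. R. Ringrose,
*Fundamentals of the Theory of Operator Algebras I*, §4.5.
-/

open scoped ComplexOrder InnerProductSpace

noncomputable section

namespace Literature.MathematicalPhysics.QuantumLattice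

variable {A : Type*} [CStarAlgebra A] [PartialOrder A]

variable (A) in
/-- A *state* on a unital C⋆-algebra `A`: a positive linear functional `ω : A →ₚ[ℂ] ℂ` normalised by
`ω 1 = 1` (Bratteli–Robinson I §2.3.2; Kadison–Ringrose I §4.5: "positive linear
functional of norm one", equivalent for unital `A` by BR I Prop. 2.3.11). [folklore] -/
structure State where
  /-- The underlying positive linear functional. -/
  toPositiveLinearMap : A →ₚ[ℂ] ℂ
  /-- Normalisation `ω 1 = 1`. -/
  map_one' : toPositiveLinearMap 1 = 1

namespace State

/-- States are functions `A → ℂ` (Bratteli–Robinson I §2.3.2). [folklore] -/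
instance instFunLike : FunLike (State A) A ℂ where
  coe ω := ω.toPositiveLinearMap
  coe_injective ω₁ ω₂ h := by
    cases ω₁; cases ω₂; congr; exact DFunLike.coe_injective h

/-- States are `ℂ`-linear maps (Bratteli–Robinson I §2.3.2). [folklore] -/
instance instLinearMapClass : LinearMapClass (State A) ℂ A ℂ where
  map_add ω := map_add ω.toPositiveLinearMap
  map_smulₛₗ ω := map_smul ω.toPositiveLinearMap

/-- States are monotone (positive) maps (Bratteli–Robinson I §2.3.2). [folklore] -/
instance instOrderHomClass : OrderHomClass (State A) A ℂ where
  map_rel ω _ _ h := OrderHomClass.mono ω.toPositiveLinearMap h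

/-- Two states are equal if they agree pointwise (Bratteli–Robinson I §2.3.2). [folklore] -/
@[ext]
lemma ext {ω₁ ω₂ : State A} (h : ∀ a, ω₁ a = ω₂ a) : ω₁ = ω₂ :=
  DFunLike.ext _ _ h

/-- The underlying positive linear map of a state coerces to the same function. [folklore] -/
@[simp]
lemma coe_toPositiveLinearMap (ω : State A) : (ω.toPositiveLinearMap : A → ℂ) = ω := rfl

/-- A state is normalised: `ω 1 = 1` (Bratteli–Robinson I §2.3.2). [folklore] -/
@[simp]
lemma map_one (ω : State A) : ω 1 = 1 := ω.map_one'

/-- A state is positive: `0 ≤ a → 0 ≤ ω a` (Bratteli–Robinson I §2.3.2). [folklore] -/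
lemma map_nonneg (ω : State A) {a : A} (ha : 0 ≤ a) : 0 ≤ ω a :=
  ω.toPositiveLinearMap.map_nonneg ha

variable [StarOrderedRing A]

/-- A state as a continuous linear functional; continuity is automatic for positive maps between
C⋆-algebras (Mathlib `PositiveLinearMap.exists_norm_apply_le`; Bratteli–Robinson I Prop. 2.3.11). [folklore] -/
def toContinuousLinearMap (ω : State A) : A →L[ℂ] ℂ :=
  { (ω.toPositiveLinearMap : A →ₗ[ℂ] ℂ) with
    cont := map_continuous ω.toPositiveLinearMap }

/-- `State.toContinuousLinearMap` is the same function as the state. [folklore] -/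
@[simp]
lemma toContinuousLinearMap_apply (ω : State A) (a : A) : ω.toContinuousLinearMap a = ω a := rfl

/-- A state as an element of the weak-⋆ dual `WeakDual ℂ A` (Bratteli–Robinson I §2.3.2,
Thm. 2.3.15). [folklore] -/
def toWeakDual (ω : State A) : WeakDual ℂ A :=
  StrongDual.toWeakDual ω.toContinuousLinearMap

/-- `State.toWeakDual` is the same function as the state. [folklore] -/
@[simp]
lemma toWeakDual_apply (ω : State A) (a : A) : ω.toWeakDual a = ω a := rfl

/-- `State.toWeakDual` is injective (a state is determined by its values). [folklore] -/
lemma toWeakDual_injective : Function.Injective (toWeakDual : State A → WeakDual ℂ A) := by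
  intro ω₁ ω₂ h
  ext a
  simpa using congrArg (fun φ : WeakDual ℂ A => φ a) h

end State

variable (A) in
/-- The *state space* of a unital C⋆-algebra, as a subset of the weak-⋆ dual: the continuous
functionals that are positive and normalised, `E_A = {φ | (∀ a ≥ 0, 0 ≤ φ a) ∧ φ 1 = 1}`
(Bratteli–Robinson I §2.3.2, Thm. 2.3.15). [folklore] -/
def stateSpace : Set (WeakDual ℂ A) :=
  {φ | (∀ a : A, 0 ≤ a → 0 ≤ φ a) ∧ φ 1 = 1}

/-- Membership in the state space unfolds to positivity and normalisation
(Bratteli–Robinson I §2.3.2). [folklore] -/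
lemma mem_stateSpace_iff (φ : WeakDual ℂ A) :
    φ ∈ stateSpace A ↔ (∀ a : A, 0 ≤ a → 0 ≤ φ a) ∧ φ 1 = 1 := Iff.rfl

variable [StarOrderedRing A]

/-- The weak-⋆ functional of a state lies in the state space (Bratteli–Robinson I §2.3.2). [folklore] -/
lemma State.toWeakDual_mem_stateSpace (ω : State A) : ω.toWeakDual ∈ stateSpace A :=
  ⟨fun _ ha => ω.map_nonneg ha, ω.map_one⟩

/-- The state space is exactly the range of `State.toWeakDual` (Bratteli–Robinson I §2.3.2). [cite: BratteliRobinsonI1987, §2.3.2] -/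
def range_toWeakDual : Prop :=
  Set.range (State.toWeakDual : State A → WeakDual ℂ A) = stateSpace A

/-- A state is *pure* if it is an extreme point of the (convex, weak-⋆ compact) state space
(Bratteli–Robinson I Def. 2.3.14 and Thm. 2.3.15; Kadison–Ringrose I §4.5 / Def. 3.4.5). [folklore] -/
def IsPureState (ω : State A) : Prop :=
  ω.toWeakDual ∈ Set.extremePoints ℝ (stateSpace A)

/-- The state space is convex (over `ℝ`) in the weak-⋆ dual (Bratteli–Robinson I Thm. 2.3.15). [cite: BratteliRobinsonI1987, Thm. 2.3.15] -/
def convex_stateSpace : Prop :=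
  Convex ℝ (stateSpace A)

/-- The state space of a unital C⋆-algebra is weak-⋆ compact (Banach–Alaoglu; Bratteli–Robinson I
Thm. 2.3.15, using `‖φ‖ = φ 1 = 1` and Mathlib `WeakDual.isCompact_closedBall`). [cite: BratteliRobinsonI1987, Thm. 2.3.15] -/
def isCompact_stateSpace : Prop :=
  IsCompact (stateSpace A)

namespace State

/-- A state is contractive: `‖ω a‖ ≤ ‖a‖`, i.e. `‖ω‖ ≤ 1` (in fact `‖ω‖ = ω 1 = 1`;
Bratteli–Robinson I Prop. 2.3.11, Kadison–Ringrose I Thm. 4.3.2). [cite: BratteliRobinsonI1987, Prop. 2.3.11] -/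
def norm_apply_le_norm : Prop :=
  ∀ (ω : State A) (a : A),
    ‖ω a‖ ≤ ‖a‖

/-- The Cauchy–Schwarz inequality for states:
`‖ω (star a * b)‖ ^ 2 ≤ ω (star a * a) * ω (star b * b)` (as real numbers;
Bratteli–Robinson I Lemma 2.3.10 (b)). [cite: BratteliRobinsonI1987, Lemma 2.3.10(b)] -/
def norm_apply_star_mul_sq_le : Prop :=
  ∀ (ω : State A) (a b : A),
    ‖ω (star a * b)‖ ^ 2 ≤ (ω (star a * a)).re * (ω (star b * b)).re

/-! ### The GNS triple -/

/-- The GNS Hilbert space `𝓗_ω` of a state: the completion of `A / {a | ω (a⋆ a) = 0}` for the inner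
product `⟪a, b⟫ = ω (a⋆ b)`. This is Mathlib's `PositiveLinearMap.GNS`
(Bratteli–Robinson I §2.3.3). [folklore] -/
abbrev gnsSpace (ω : State A) : Type _ := ω.toPositiveLinearMap.GNS

/-- The GNS representation `π_ω : A →⋆ₐ[ℂ] 𝓑(𝓗_ω)`, acting by left multiplication. This is Mathlib's
`PositiveLinearMap.gnsStarAlgHom` (Bratteli–Robinson I §2.3.3, Thm. 2.3.16). [folklore] -/
abbrev gnsRep (ω : State A) : A →⋆ₐ[ℂ] (ω.gnsSpace →L[ℂ] ω.gnsSpace) :=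
  ω.toPositiveLinearMap.gnsStarAlgHom

/-- The GNS cyclic vector `Ω_ω ∈ 𝓗_ω`: the image of `1 ∈ A` in the completion of the pre-GNS space
(Bratteli–Robinson I §2.3.3, Thm. 2.3.16; this fills the TODO in Mathlib's
`Analysis/CStarAlgebra/GelfandNaimarkSegal.lean` for unital `A`). [folklore] -/
def gnsVector (ω : State A) : ω.gnsSpace :=
  ((ω.toPositiveLinearMap.toPreGNS 1 : ω.toPositiveLinearMap.PreGNS) : ω.toPositiveLinearMap.GNS)

/-- The GNS vector of a state is a unit vector: `‖Ω_ω‖ = 1` since `‖Ω_ω‖² = ω (1⋆ 1) = 1`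
(Bratteli–Robinson I Thm. 2.3.16). [cite: BratteliRobinsonI1987, Thm. 2.3.16] -/
def norm_gnsVector : Prop :=
  ∀ (ω : State A),
    ‖ω.gnsVector‖ = 1

/-- The GNS vector represents the state: `⟪Ω_ω, π_ω(a) Ω_ω⟫ = ω a`
(Bratteli–Robinson I Thm. 2.3.16). [cite: BratteliRobinsonI1987, Thm. 2.3.16] -/
def inner_gnsVector_gnsRep : Prop :=
  ∀ (ω : State A) (a : A),
    ⟪ω.gnsVector, ω.gnsRep a ω.gnsVector⟫_ℂ = ω a

/-- Discharge of `inner_gnsVector_gnsRep`: `⟪Ω_ω, π_ω(a) Ω_ω⟫ = ω a` for every state `ω` and every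
`a : A`. This is the identification `(Ω_ω, π_ω(A) Ω_ω) = (ψ_𝟙, ψ_A) = ω(A)` in the GNS construction of
Bratteli–Robinson I §2.3.3 (proof preceding Thm. 2.3.16, unital case `Ω_ω = ψ_𝟙`): here `Ω_ω` is the
image of `1` in the completion, `π_ω(a)` restricted to the dense image of `A` is left multiplication
(Mathlib `PositiveLinearMap.gnsNonUnitalStarAlgHom_apply_coe`), the inner product on that image is
`⟪[b], [c]⟫ = ω (b⋆ c)` (Mathlib `PositiveLinearMap.preGNS_inner_def`,
`UniformSpace.Completion.inner_coe`), and `ω (1⋆ (a 1)) = ω a`.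
[cite: BratteliRobinsonI1987, §2.3.3, Thm. 2.3.16] -/
theorem inner_gnsVector_gnsRep_holds : inner_gnsVector_gnsRep (A := A) := by
  intro ω a
  -- `π_ω(a)` is (the completion of) left multiplication by `a` on the pre-GNS space
  have h : ω.gnsRep a = ω.toPositiveLinearMap.gnsNonUnitalStarAlgHom a := rfl
  -- `Ω_ω = [1]` lies in the dense image of `A`, where `π_ω(a) [1] = [a 1]` and `⟪[1], [b]⟫ = ω (1⋆ b)`
  rw [h, gnsVector, PositiveLinearMap.gnsNonUnitalStarAlgHom_apply_coe,
    UniformSpace.Completion.inner_coe, PositiveLinearMap.preGNS_inner_def]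
  simp only [PositiveLinearMap.ofPreGNS_toPreGNS, star_one,
    PositiveLinearMap.leftMulMapPreGNS_apply, mul_one, one_mul, coe_toPositiveLinearMap]

/-- On the dense image of `A`, the GNS representation applied to the cyclic vector recovers the
class of `a`: `π_ω(a) Ω_ω = [a]` (Bratteli–Robinson I §2.3.3). [cite: BratteliRobinsonI1987, §2.3.3] -/
def gnsRep_gnsVector : Prop :=
  ∀ (ω : State A) (a : A),
    ω.gnsRep a ω.gnsVector =
      ((ω.toPositiveLinearMap.toPreGNS a : ω.toPositiveLinearMap.PreGNS) :
        ω.toPositiveLinearMap.GNS)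

/-- The GNS vector is cyclic: `π_ω(A) Ω_ω` is dense in `𝓗_ω` (Bratteli–Robinson I Thm. 2.3.16). [cite: BratteliRobinsonI1987, Thm. 2.3.16] -/
def gnsVector_cyclic : Prop :=
  ∀ (ω : State A),
    DenseRange (fun a : A => ω.gnsRep a ω.gnsVector)

/-! ### Pull-back of states -/

variable {B : Type*} [CStarAlgebra B] [PartialOrder B] [StarOrderedRing B]

/-- Pull-back of a state along a unital ⋆-algebra homomorphism `π : B →⋆ₐ[ℂ] A`:
`(ω.comap π) b = ω (π b)`. Positivity holds because ⋆-homomorphisms between C⋆-algebras are positive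
(Mathlib `map_nonneg` for `StarRingHomClass`), and `π 1 = 1` (Bratteli–Robinson I §2.3.2). [folklore] -/
def comap (ω : State A) (π : B →⋆ₐ[ℂ] A) : State B where
  toPositiveLinearMap :=
    .mk₀ ((ω.toPositiveLinearMap : A →ₗ[ℂ] ℂ) ∘ₗ π.toLinearMap) fun b hb =>
      ω.map_nonneg (show 0 ≤ π b from _root_.map_nonneg π hb)
  map_one' := by
    change ω (π 1) = 1
    rw [_root_.map_one, ω.map_one]

/-- The pull-back state evaluates as `ω ∘ π` (Bratteli–Robinson I §2.3.2). [folklore] -/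
@[simp]
lemma comap_apply (ω : State A) (π : B →⋆ₐ[ℂ] A) (b : B) : ω.comap π b = ω (π b) := rfl

end State

/-! ### Pure states and irreducibility -/

/-- A ⋆-representation `π : A →⋆ₐ[ℂ] 𝓑(H)` on a Hilbert space is *irreducible* if its commutant is
trivial: every bounded operator commuting with all `π a` is a scalar (Bratteli–Robinson I Def. 2.3.7
and Prop. 2.3.8, equivalence (1) ⇔ (2) with "no non-trivial closed invariant subspace"). [folklore] -/
def IsIrreducibleRep {H : Type*} [NormedAddCommGroup H] [InnerProductSpace ℂ H] [CompleteSpace H]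
    (π : A →⋆ₐ[ℂ] (H →L[ℂ] H)) : Prop :=
  Subalgebra.centralizer ℂ (Set.range π) = ⊥

/-- A state is pure iff its GNS representation is irreducible (Bratteli–Robinson I Thm. 2.3.19;
Kadison–Ringrose II Thm. 10.2.3). [cite: BratteliRobinsonI1987, Thm. 2.3.19] -/
def isPureState_iff_irreducible : Prop :=
  ∀ (ω : State A),
    IsPureState ω ↔ IsIrreducibleRep ω.gnsRep

end Literature.MathematicalPhysics.QuantumLattice

end
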